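import Summits.CriticalPhenomena.PercolationContinuityZ3.Theorems.PercNearOneGluingNoHeavyLowerTailRMaxReduction
import Summits.CriticalPhenomena.PercolationContinuityZ3.Theorems.PercNearOneGluingAdditiveGluingGluePushforward
import Literature.Probability.Percolation.PercolationEvents
import HarnessLib

/-!
# `NoHeavyLowerTail` (stmt-CriticalPhenomena-4575) — PRE-GLUING BEATING: a relay that beats `q` before a block is glued
# still beats `q` away from the glued block (GREX-1 for `|Q| = 1`)

Support file (lemma factory #8 `prim-lf-8`, gen 11; `--supports stmt-CriticalPhenomena-4575`).  No definitions, no named facts,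
no sorries.  `μ_v = prodBernoulli v` on `Fin n`, relays `A`, level `j`, `π(z) = {a ∈ A : z ↔ a}`, `L_z = {|π(z)| ≤ j}`,
`H_z = {|π(z)| > j}`, `S_v(z) = μ_v(L_z)`.  For a finite vertex set `B`, `glue_B w` is `w` with every pair inside `B` raised to weight `1`
(`K_B` = the non-diagonal pairs inside `B`; `stub_gluePushforward`: `μ_{glue_B w}(E) = μ_w{ω | ω ∪ K_B ∈ E}`).

Companion of `…PreGluingExchange.lean` (GREX-0 at `|Q| = 1`).  Together they are the `|Q| = 1` case of the glued restricted-attachment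
exchange GREX (prim-lf-8 CANDIDATES v10 B10-2), the root conjecture behind `CornerReduction.noHeavyLowerTail_of_grex`.

* `PreGluingBeating.reach_union_clique_of_not_reach` — if `x` reaches no vertex of `B` in `ω`, then gluing `B` changes nothing seen
  from `x`: `x ↔ r` in `ω ∪ K_B` iff `x ↔ r` in `ω` (walk induction: a walk from `x` never enters `B`, so it uses no pair of `K_B`).
* `PreGluingBeating.beats_on_typeMinus` — **SIMPLE-1, quantitative**: for an event `E` of type `(−)` in the frame `({x},{q})`,
  `μ(E ∩ L_x ∩ H_q) · μ(H_x ∩ L_q) ≥ μ(E ∩ H_x ∩ L_q) · μ(L_x ∩ H_q)` (one BHK two-set exchange); hence if `x` beats `q`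
  (`S(q) ≤ S(x)`) then `μ(E ∩ L_x) ≥ μ(E ∩ L_q)` (`beats_restrict_typeMinus`) — beating by the WINNER survives on every `(−)`-event,
  e.g. on `{x ↮ v}` for any vertex `v` (seat census SIMPLE-1: 0 / 17 181).
* `PreGluingBeating.grexOne_singleton` — **GREX-1 for `|Q| = 1`**: if `x` beats `q` in `w` (`x ∉ B`) then in the glued weights
  `glue_B w`, for any `c ∈ B`, `μ({c ↮ x} ∩ L_x) ≥ μ({c ↮ x} ∩ L_q)`: away from the glued block, `x` still beats `q` — although after
  gluing `x` need not beat `q` globally.  (Pushforward to `w`: `{c ↮ x}` pulls back to `E = ⋂_{b∈B} {x ↮ b}`, a `(−)`-event on which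
  `x`'s relay set is unchanged and `q`'s can only grow.)
-/

noncomputable section

namespace Summit.CriticalPhenomena.PercolationContinuityZ3.Theorems

open MeasureTheory Set Literature.Probability.LatticeModels Literature.Probability.Percolation
open scoped Classical BigOperators

variable {n : ℕ}

namespace PreGluingBeating

open ConditionedChampionExchange

/-! ### Walks that avoid a glued clique -/

/-- If `u` reaches no vertex of `B` in `ω`, then every vertex reachable from `u` in `ω ∪ K_B` is reachable in `ω`
(`K_B` = the non-diagonal pairs inside `B`). [folklore] -/
theorem reach_union_clique_of_not_reach (B : Finset (Fin n)) (ω : BondConfig (Fin n)) :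
    ∀ (u r : Fin n), (openGraph (ω ∪ {e : Sym2 (Fin n) | (∀ y ∈ e, y ∈ B) ∧ ¬ e.IsDiag})).Reachable u r →
      (∀ b ∈ B, ¬ (openGraph ω).Reachable u b) → (openGraph ω).Reachable u r := by
  intro u r h
  obtain ⟨p⟩ := h
  induction p with
  | nil => intro _; exact SimpleGraph.Reachable.refl _
  | @cons u v r' hadj p ih =>
    intro hB
    rw [openGraph_adj] at hadj
    obtain ⟨hmem, huv⟩ := hadj
    -- the first pair is not a clique pair (else `u ∈ B`), hence open in `ω`
    have hω : s(u, v) ∈ ω := by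
      rcases hmem with h | h
      · exact h
      · exfalso
        simp only [mem_setOf_eq, Sym2.mem_iff, forall_eq_or_imp, forall_eq] at h
        exact hB u h.1.1 (SimpleGraph.Reachable.refl _)
    have h1 : (openGraph ω).Reachable u v := SimpleGraph.Adj.reachable ((openGraph_adj ω u v).2 ⟨hω, huv⟩)
    have hBv : ∀ b ∈ B, ¬ (openGraph ω).Reachable v b := fun b hb hvb => hB b hb (h1.trans hvb)
    exact h1.trans (ih hBv)

/-- On `E = {x ↮ b for all b ∈ B}` the relay set of `x` is unchanged by gluing `B`. [folklore] -/
theorem filter_union_clique_eq (A B : Finset (Fin n)) (x : Fin n) (ω : BondConfig (Fin n))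
    (hE : ∀ b ∈ B, ¬ (openGraph ω).Reachable x b) :
    (A.filter fun r => (ω ∪ {e : Sym2 (Fin n) | (∀ y ∈ e, y ∈ B) ∧ ¬ e.IsDiag}) ∈ openConn x r) =
      A.filter fun r => ω ∈ openConn x r := by
  apply Finset.filter_congr
  intro r _
  constructor
  · exact fun h => reach_union_clique_of_not_reach B ω x r h hE
  · exact fun h => SimpleGraph.Reachable.mono (openGraph_mono subset_union_left) h

/-- Gluing only adds connections: the relay set of any vertex grows. [folklore] -/
theorem filter_subset_union_clique (A B : Finset (Fin n)) (q : Fin n) (ω : BondConfig (Fin n)) :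
    (A.filter fun r => ω ∈ openConn q r) ⊆
      A.filter fun r => (ω ∪ {e : Sym2 (Fin n) | (∀ y ∈ e, y ∈ B) ∧ ¬ e.IsDiag}) ∈ openConn q r := by
  intro r hr
  simp only [Finset.mem_filter] at hr ⊢
  exact ⟨hr.1, SimpleGraph.Reachable.mono (openGraph_mono subset_union_left) hr.2⟩

/-- After gluing `B ∋ c`, `c ↮ x` iff `x` reached no vertex of `B` before. [folklore] -/
theorem not_reach_glued_iff (B : Finset (Fin n)) {c x : Fin n} (hc : c ∈ B) (ω : BondConfig (Fin n)) :
    ¬ (openGraph (ω ∪ {e : Sym2 (Fin n) | (∀ y ∈ e, y ∈ B) ∧ ¬ e.IsDiag})).Reachable c x ↔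
      ∀ b ∈ B, ¬ (openGraph ω).Reachable x b := by
  constructor
  · intro h b hb hxb
    apply h
    have h1 : (openGraph (ω ∪ {e : Sym2 (Fin n) | (∀ y ∈ e, y ∈ B) ∧ ¬ e.IsDiag})).Reachable x b :=
      SimpleGraph.Reachable.mono (openGraph_mono subset_union_left) hxb
    have h2 : (openGraph (ω ∪ {e : Sym2 (Fin n) | (∀ y ∈ e, y ∈ B) ∧ ¬ e.IsDiag})).Reachable b c := by
      by_cases hbc : b = c
      · subst hbc; exact SimpleGraph.Reachable.refl _
      · refine SimpleGraph.Adj.reachable ((openGraph_adj _ b c).2 ⟨Or.inr ?_, hbc⟩)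
        simp only [mem_setOf_eq, Sym2.mem_iff, forall_eq_or_imp, forall_eq, Sym2.mk_isDiag_iff]
        exact ⟨⟨hb, hc⟩, hbc⟩
    exact (h1.trans h2).symm
  · intro hE hcx
    have := reach_union_clique_of_not_reach B ω x c hcx.symm hE
    exact hE c hc this

/-! ### Beating by the winner survives on `(−)`-events -/

/-- **Quantitative SIMPLE-1.**  For an event `E` of type `(−)` in the frame `({x},{q})`:
`μ(E ∩ H_x ∩ L_q) · μ(L_x ∩ H_q) ≤ μ(E ∩ L_x ∩ H_q) · μ(H_x ∩ L_q)`.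
[cite: VandenbergHaggstromKahn2005, Thm. 2.1 (p. 9) at q = 1 — corollary] -/
theorem beats_on_typeMinus (w : Sym2 (Fin n) → unitInterval) (A : Finset (Fin n)) (x q : Fin n) (j : ℕ)
    {E : Set (BondConfig (Fin n))}
    (hE : ∀ ⦃ω ω' : BondConfig (Fin n)⦄,
      (⋃ s ∈ ({x} : Set (Fin n)), openEdgeCluster ω' s) ⊆ (⋃ s ∈ ({x} : Set (Fin n)), openEdgeCluster ω s) →
      (⋃ t ∈ ({q} : Set (Fin n)), openEdgeCluster ω t) ⊆ (⋃ t ∈ ({q} : Set (Fin n)), openEdgeCluster ω' t) →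
      ω ∈ E → ω' ∈ E) :
    (prodBernoulli w).real ((E ∩ {ω : BondConfig (Fin n) | j < (A.filter fun r => ω ∈ openConn x r).card}) ∩
          {ω | (A.filter fun r => ω ∈ openConn q r).card ≤ j}) *
      (prodBernoulli w).real ({ω : BondConfig (Fin n) | (A.filter fun r => ω ∈ openConn x r).card ≤ j} ∩
          {ω | j < (A.filter fun r => ω ∈ openConn q r).card}) ≤
    (prodBernoulli w).real ((E ∩ {ω : BondConfig (Fin n) | (A.filter fun r => ω ∈ openConn x r).card ≤ j}) ∩
          {ω | j < (A.filter fun r => ω ∈ openConn q r).card}) *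
      (prodBernoulli w).real ({ω : BondConfig (Fin n) | j < (A.filter fun r => ω ∈ openConn x r).card} ∩
          {ω | (A.filter fun r => ω ∈ openConn q r).card ≤ j}) := by
  set μ := prodBernoulli w with hμ
  set D : Set (BondConfig (Fin n)) := (openConn x q : Set (BondConfig (Fin n)))ᶜ with hD
  set Lx : Set (BondConfig (Fin n)) := {ω | (A.filter fun r => ω ∈ openConn x r).card ≤ j} with hLx
  set Hx : Set (BondConfig (Fin n)) := {ω | j < (A.filter fun r => ω ∈ openConn x r).card} with hHx
  set Lq : Set (BondConfig (Fin n)) := {ω | (A.filter fun r => ω ∈ openConn q r).card ≤ j} with hLq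
  set Hq : Set (BondConfig (Fin n)) := {ω | j < (A.filter fun r => ω ∈ openConn q r).card} with hHq
  -- BHK with `A₁ = H_x ∩ L_q` (+), `B₁ = E` (−), `A₂ = univ`, `B₂ = L_x ∩ H_q` (−)
  have key := setTwoClusterExchange w ({x} : Set (Fin n)) ({q} : Set (Fin n))
    (A₁ := Hx ∩ Lq) (A₂ := univ) (B₁ := E) (B₂ := Lx ∩ Hq)
    (fun ω ω' hs ht h => ⟨heavy_typePlus A x q j hs ht h.1, light_typePlus A x q j hs ht h.2⟩)
    (fun _ _ _ _ _ => mem_univ _)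
    (fun ω ω' hs ht h => hE hs ht h)
    (fun ω ω' hs ht h => ⟨light_typePlus A q x j ht hs h.1, heavy_typePlus A q x j ht hs h.2⟩)
  rw [sep_singletons_eq x q] at key
  simp only [inter_univ, univ_inter] at key
  change μ.real (D ∩ ((Hx ∩ Lq) ∩ E)) * μ.real (D ∩ (Lx ∩ Hq)) ≤ μ.real (D ∩ (Hx ∩ Lq)) * μ.real (D ∩ (E ∩ (Lx ∩ Hq))) at key
  have hLH : Lx ∩ Hq ⊆ D := by
    rintro ω ⟨hl, hh⟩ hk
    simp only [hLx, hHq, mem_setOf_eq] at hl hh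
    rw [filter_eq_of_openConn A hk] at hl
    exact absurd hl (not_le.2 hh)
  have hHL : Hx ∩ Lq ⊆ D := by
    rintro ω ⟨hh, hl⟩ hk
    simp only [hHx, hLq, mem_setOf_eq] at hl hh
    rw [filter_eq_of_openConn A hk] at hh
    exact absurd hl (not_le.2 hh)
  have e1 : D ∩ ((Hx ∩ Lq) ∩ E) = (E ∩ Hx) ∩ Lq := by
    ext ω; constructor
    · rintro ⟨-, ⟨hh, hl⟩, he⟩; exact ⟨⟨he, hh⟩, hl⟩
    · rintro ⟨⟨he, hh⟩, hl⟩; exact ⟨hHL ⟨hh, hl⟩, ⟨hh, hl⟩, he⟩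
  have e2 : D ∩ (Lx ∩ Hq) = Lx ∩ Hq := inter_eq_right.2 hLH
  have e3 : D ∩ (Hx ∩ Lq) = Hx ∩ Lq := inter_eq_right.2 hHL
  have e4 : D ∩ (E ∩ (Lx ∩ Hq)) = (E ∩ Lx) ∩ Hq := by
    ext ω; constructor
    · rintro ⟨-, he, hl, hh⟩; exact ⟨⟨he, hl⟩, hh⟩
    · rintro ⟨⟨he, hl⟩, hh⟩; exact ⟨hLH ⟨hl, hh⟩, he, hl, hh⟩
  rw [e1, e2, e3, e4] at key
  linarith [key]

/-- **SIMPLE-1.**  If `x` beats `q` (`S(q) ≤ S(x)`) then `x` beats `q` on every `(−)`-event `E` of the frame `({x},{q})`: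
`μ(E ∩ L_q) ≤ μ(E ∩ L_x)`. [this work] -/
theorem beats_restrict_typeMinus (w : Sym2 (Fin n) → unitInterval) (A : Finset (Fin n)) (x q : Fin n) (j : ℕ)
    {E : Set (BondConfig (Fin n))}
    (hE : ∀ ⦃ω ω' : BondConfig (Fin n)⦄,
      (⋃ s ∈ ({x} : Set (Fin n)), openEdgeCluster ω' s) ⊆ (⋃ s ∈ ({x} : Set (Fin n)), openEdgeCluster ω s) →
      (⋃ t ∈ ({q} : Set (Fin n)), openEdgeCluster ω t) ⊆ (⋃ t ∈ ({q} : Set (Fin n)), openEdgeCluster ω' t) →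
      ω ∈ E → ω' ∈ E)
    (hbeat : (prodBernoulli w).real {ω : BondConfig (Fin n) | (A.filter fun r => ω ∈ openConn q r).card ≤ j} ≤
      (prodBernoulli w).real {ω : BondConfig (Fin n) | (A.filter fun r => ω ∈ openConn x r).card ≤ j}) :
    (prodBernoulli w).real (E ∩ {ω : BondConfig (Fin n) | (A.filter fun r => ω ∈ openConn q r).card ≤ j}) ≤
      (prodBernoulli w).real (E ∩ {ω : BondConfig (Fin n) | (A.filter fun r => ω ∈ openConn x r).card ≤ j}) := by
  set μ := prodBernoulli w with hμ
  set Lx : Set (BondConfig (Fin n)) := {ω | (A.filter fun r => ω ∈ openConn x r).card ≤ j} with hLx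
  set Hx : Set (BondConfig (Fin n)) := {ω | j < (A.filter fun r => ω ∈ openConn x r).card} with hHx
  set Lq : Set (BondConfig (Fin n)) := {ω | (A.filter fun r => ω ∈ openConn q r).card ≤ j} with hLq
  set Hq : Set (BondConfig (Fin n)) := {ω | j < (A.filter fun r => ω ∈ openConn q r).card} with hHq
  have hmeas : ∀ s : Set (BondConfig (Fin n)), MeasurableSet s := fun _ => MeasurableSet.of_discrete
  have hnn : ∀ s : Set (BondConfig (Fin n)), 0 ≤ μ.real s := fun _ => measureReal_nonneg
  have mono : ∀ {s t : Set (BondConfig (Fin n))}, s ⊆ t → μ.real s ≤ μ.real t :=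
    fun h => measureReal_mono h (measure_ne_top μ _)
  -- `cc_x ≥ CC_x` from `S(q) ≤ S(x)`
  have hb : μ.real (Hx ∩ Lq) ≤ μ.real (Lx ∩ Hq) := by
    have := RMaxReduction.lightHeavy_le_of_beats w A q x j hbeat
    rw [inter_comm] at this
    simpa only [inter_comm] using this
  have key := beats_on_typeMinus w A x q j hE
  change μ.real ((E ∩ Hx) ∩ Lq) * μ.real (Lx ∩ Hq) ≤ μ.real ((E ∩ Lx) ∩ Hq) * μ.real (Hx ∩ Lq) at key
  -- split both sides of the goal along `L_x / H_x` resp. `L_q / H_q`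
  have hHc : ∀ ω : BondConfig (Fin n), ω ∉ Lx ↔ ω ∈ Hx := by
    intro ω; simp only [hLx, hHx, mem_setOf_eq, not_le]
  have hHqc : ∀ ω : BondConfig (Fin n), ω ∉ Lq ↔ ω ∈ Hq := by
    intro ω; simp only [hLq, hHq, mem_setOf_eq, not_le]
  have s1 : μ.real (E ∩ Lq) = μ.real (E ∩ Lq ∩ Lx) + μ.real ((E ∩ Hx) ∩ Lq) := by
    rw [← measureReal_inter_add_sdiff (μ := μ) (s := E ∩ Lq) (t := Lx) (hmeas _)]
    congr 1
    congr 1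
    ext ω; simp only [mem_sdiff, mem_inter_iff, hHc]; tauto
  have s2 : μ.real (E ∩ Lx) = μ.real (E ∩ Lx ∩ Lq) + μ.real ((E ∩ Lx) ∩ Hq) := by
    rw [← measureReal_inter_add_sdiff (μ := μ) (s := E ∩ Lx) (t := Lq) (hmeas _)]
    congr 1
    congr 1
    ext ω; simp only [mem_sdiff, mem_inter_iff, hHqc]
  have s3 : E ∩ Lq ∩ Lx = E ∩ Lx ∩ Lq := by ext ω; simp only [mem_inter_iff]; tauto
  rw [s1, s2, s3]
  -- it remains: `μ(E ∩ H_x ∩ L_q) ≤ μ(E ∩ L_x ∩ H_q)`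
  suffices h : μ.real ((E ∩ Hx) ∩ Lq) ≤ μ.real ((E ∩ Lx) ∩ Hq) by linarith
  by_cases hpos : 0 < μ.real (Hx ∩ Lq)
  · have h1 : μ.real ((E ∩ Hx) ∩ Lq) * μ.real (Hx ∩ Lq) ≤ μ.real ((E ∩ Lx) ∩ Hq) * μ.real (Hx ∩ Lq) :=
      le_trans (mul_le_mul_of_nonneg_left hb (hnn _)) key
    exact le_of_mul_le_mul_right h1 hpos
  · have h0 : μ.real (Hx ∩ Lq) = 0 := le_antisymm (not_lt.1 hpos) (hnn _)
    have : μ.real ((E ∩ Hx) ∩ Lq) ≤ μ.real (Hx ∩ Lq) := mono (fun ω hω => ⟨hω.1.2, hω.2⟩)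
    linarith [hnn ((E ∩ Lx) ∩ Hq)]

/-! ### GREX-1 for one relay -/

/-- **GREX-1 for `|Q| = 1` (pre-gluing beating).**  Let `B` be a finite vertex set, `c ∈ B` (the interesting case is `x ∉ B`), and let `glue_B w` raise every
pair inside `B` to weight `1`.  If `x` beats `q` in `w` (`S_w(q) ≤ S_w(x)`) then, in the glued weights, `x` beats `q` away from the
block: `μ_{glue_B w}({c ↮ x} ∩ L_q) ≤ μ_{glue_B w}({c ↮ x} ∩ L_x)`. [this work] -/
theorem grexOne_singleton (w : Sym2 (Fin n) → unitInterval) (A B : Finset (Fin n)) (x c q : Fin n) (j : ℕ)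
    (hc : c ∈ B)
    (hbeat : (prodBernoulli w).real {ω : BondConfig (Fin n) | (A.filter fun r => ω ∈ openConn q r).card ≤ j} ≤
      (prodBernoulli w).real {ω : BondConfig (Fin n) | (A.filter fun r => ω ∈ openConn x r).card ≤ j}) :
    (prodBernoulli (fun e : Sym2 (Fin n) => if (∀ y ∈ e, y ∈ B) ∧ ¬ e.IsDiag then 1 else w e)).real
        ((openConn c x : Set (BondConfig (Fin n)))ᶜ ∩ {ω | (A.filter fun r => ω ∈ openConn q r).card ≤ j}) ≤
      (prodBernoulli (fun e : Sym2 (Fin n) => if (∀ y ∈ e, y ∈ B) ∧ ¬ e.IsDiag then 1 else w e)).real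
        ((openConn c x : Set (BondConfig (Fin n)))ᶜ ∩ {ω | (A.filter fun r => ω ∈ openConn x r).card ≤ j}) := by
  set K : Set (Sym2 (Fin n)) := {e : Sym2 (Fin n) | (∀ y ∈ e, y ∈ B) ∧ ¬ e.IsDiag} with hK
  set E : Set (BondConfig (Fin n)) := {ω | ∀ b ∈ B, ¬ (openGraph ω).Reachable x b} with hEdef
  rw [stub_gluePushforward n w B, stub_gluePushforward n w B]
  -- pull the two events back to `w`
  have pq : {ω : BondConfig (Fin n) | ω ∪ K ∈ ((openConn c x : Set (BondConfig (Fin n)))ᶜ ∩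
        {ω | (A.filter fun r => ω ∈ openConn q r).card ≤ j})} ⊆
      E ∩ {ω | (A.filter fun r => ω ∈ openConn q r).card ≤ j} := by
    intro ω hω
    simp only [mem_setOf_eq, mem_inter_iff, mem_compl_iff] at hω
    have hEω : ω ∈ E := (not_reach_glued_iff B hc ω).1 hω.1
    refine ⟨hEω, ?_⟩
    show (A.filter fun r => ω ∈ openConn q r).card ≤ j
    exact le_trans (Finset.card_le_card (filter_subset_union_clique A B q ω)) hω.2
  have px : {ω : BondConfig (Fin n) | ω ∪ K ∈ ((openConn c x : Set (BondConfig (Fin n)))ᶜ ∩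
        {ω | (A.filter fun r => ω ∈ openConn x r).card ≤ j})} =
      E ∩ {ω | (A.filter fun r => ω ∈ openConn x r).card ≤ j} := by
    ext ω
    simp only [mem_setOf_eq, mem_inter_iff, mem_compl_iff]
    constructor
    · rintro ⟨h1, h2⟩
      have hEω : ω ∈ E := (not_reach_glued_iff B hc ω).1 h1
      refine ⟨hEω, ?_⟩
      rwa [filter_union_clique_eq A B x ω hEω] at h2
    · rintro ⟨hEω, h2⟩
      refine ⟨(not_reach_glued_iff B hc ω).2 hEω, ?_⟩
      rwa [filter_union_clique_eq A B x ω hEω]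
  -- `E` is of type `(−)` for `({x},{q})`: it is the intersection of the generators `{x ↮ b}`
  have hE : ∀ ⦃ω ω' : BondConfig (Fin n)⦄,
      (⋃ s ∈ ({x} : Set (Fin n)), openEdgeCluster ω' s) ⊆ (⋃ s ∈ ({x} : Set (Fin n)), openEdgeCluster ω s) →
      (⋃ t ∈ ({q} : Set (Fin n)), openEdgeCluster ω t) ⊆ (⋃ t ∈ ({q} : Set (Fin n)), openEdgeCluster ω' t) →
      ω ∈ E → ω' ∈ E := by
    intro ω ω' hs ht h b hb
    have := TwoSetExchange.typeMinus_not_openConn_of_mem ({x} : Set (Fin n)) ({q} : Set (Fin n)) (mem_singleton x) b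
      hs ht (h b hb)
    exact this
  calc (prodBernoulli w).real {ω : BondConfig (Fin n) | ω ∪ K ∈ ((openConn c x : Set (BondConfig (Fin n)))ᶜ ∩
          {ω | (A.filter fun r => ω ∈ openConn q r).card ≤ j})}
      ≤ (prodBernoulli w).real (E ∩ {ω | (A.filter fun r => ω ∈ openConn q r).card ≤ j}) :=
        measureReal_mono pq (measure_ne_top _ _)
    _ ≤ (prodBernoulli w).real (E ∩ {ω | (A.filter fun r => ω ∈ openConn x r).card ≤ j}) :=
        beats_restrict_typeMinus w A x q j hE hbeat
    _ = (prodBernoulli w).real {ω : BondConfig (Fin n) | ω ∪ K ∈ ((openConn c x : Set (BondConfig (Fin n)))ᶜ ∩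
          {ω | (A.filter fun r => ω ∈ openConn x r).card ≤ j})} := by rw [px]

end PreGluingBeating

end Summit.CriticalPhenomena.PercolationContinuityZ3.Theorems

end
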